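/-
Copyright (c) 2026. Released under Apache 2.0 license as described in the file LICENSE.
Track B ∕ K2-LIT (cell `hodgecm-mathlib`, squad K2, ENGINE E1), crux h413 = `stmt-HodgeConjecture-24833`, route of record `HCCMUnconditional`.
Prover seat `hodgecm-mathlib-K2E3-p12` (g7).  Deal «P8 prep» (K2E1-plan (g5) 08:56:01Z), file G-a: gluing and scalarising meromorphic pieces (generic complex analysis).
-/
import Literature.NumberTheory.Automorphic.ResolventKernels      -- ★ `ContinuousLinearMap.comp_meromorphicAt`, `MeromorphicNFOn.eqOn_of_eventuallyEq`, `toMeromorphicNFOn_eventuallyEq_of_eventuallyEq`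
import Mathlib.Analysis.Meromorphic.NormalForm
import HarnessLib

/-!
# K2·E1 — `K2E1BLMeromorphicGluing`: GLUING MEROMORPHIC PIECES OVER AN EXHAUSTION OF `ℂ` AND SCALARISING A MEROMORPHIC VECTOR-VALUED SOLUTION — the two generic
# complex-analysis steps of Bernstein–Lapid's closing argument [arXiv:1911.02342, §4, last paragraph of p. 10]

Track B ∕ K2-LIT, crux h413 = `stmt-HodgeConjecture-24833`, route of record `HCCMUnconditional`; cell `hodgecm-mathlib`, squad K2, ENGINE E1 (campaign EIS-R7-BL-SPH-2, (ζ′) WIRING §3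
P8 «P8 prep»).  Prover seat `hodgecm-mathlib-K2E3-p12` (g7).  THEOREMS ONLY (no `def`, no `instance`, no notation, no named-fact hypothesis, no `sorry`); lane
`--supports stmt-HodgeConjecture-24833 --as helper` (count-neutral).  Closes no socket.  GENERIC — no automorphic content.

WHY (two design facts of the P8 closer `K2E1SphericalEisensteinMeromorphicU2`).  (D-i) Bernstein–Lapid's Hilbert-space system is LOCAL in the spectral parameter: the weight
exponent `N = 1 + sup_U |Re z|` and the test function `h` with `ĥ(z₀) ≠ 0` depend on the ball `U` [BernsteinLapid2019, p. 10], so ★ `exists_meromorphic_solution` (Thm 2.3) is run on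
each ball `D_n` of an exhaustion of `ℂ` and yields a scalar piece `Ec_n` meromorphic on `D_n`, equal to the Eisenstein series on `D_n ∩ {Re z > 1}`; (D-ii) Mathlib-meromorphic functions
agree on overlaps only on PUNCTURED neighbourhoods (`MeromorphicAt` ignores the value at the point), so the pieces are first put in NORMAL FORM (`toMeromorphicNFOn`), where the local
identity theorem is pointwise, and then patched — the pattern of ★ `Literature.NumberTheory.Automorphic.FuchsianEisensteinContinued` §1 (strips), made generic here.
§1 **`meromorphicOn_scalarisation`** — `z ↦ if z ∈ O then E z else (ĥ z)⁻¹ * Λ (v z)` is meromorphic on `D` for a meromorphic vector-valued `v`, a continuous functional `Λ`, a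
meromorphic scalar `ĥ` and ANY `E`, provided near every point of `D` eventually `z ∈ O → ĥ z ≠ 0 ∧ Λ (v z) = ĥ z * E z` (B–L: `E(g; z) = ĥ(z)⁻¹ (δ(h)ψ_z)(g)`, evaluation after `δ(h)`
being a continuous functional); **`scalarisation_eq`** (it equals `E` on `O`).
§2 **`toMeromorphicNFOn_eqOn_of_eqOn`** (normal forms of two meromorphic functions on nested preconnected opens which agree with one analytic `g` near a common point agree
POINTWISE on the smaller set) and **`exists_meromorphicNFOn_univ_of_exhaustion`** — THE GLUING: `D : ℕ → Set ℂ` open, preconnected, monotone, covering `ℂ`; `O` open, `z₁ ∈ D 0 ∩ O`;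
`g` analytic on `O`; pieces `F n` meromorphic on `D n` with `F n = g` on `D n ∩ O` ⟹ `∃ G`, `MeromorphicNFOn G univ`, `G = g` on `O`, and `G =ᶠ[𝓝[≠] z] F n` for `z ∈ D n`.
§3 **`exists_finset_forall_exists_ne_zero`** — on a compact `K`, a family of continuous `ĥ i` with `∀ z ∈ K, ∃ i, ĥ i z ≠ 0` has a finite subfamily with the same property (B–L's
«choose `h` with `ĥ(s₀) ≠ 0`» made uniform on a closed ball: finitely many equations `δ(h_i)ψ = ĥ_i(z)ψ` per ball); **`eventually_mem_inter_of_eventually`** (bookkeeping).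
HONEST LABEL: HC_CM is proved only modulo the 7 printed citations (2 remaining named inputs: hLiu418 = `stmt-HodgeConjecture-24832`, h413 = `stmt-HodgeConjecture-24833`) until rung 0
closes; this file asserts no named fact and closes no socket.
References: [BernsteinLapid2019] J. Bernstein, E. Lapid, *On the meromorphic continuation of Eisenstein series*, arXiv:1911.02342 (JAMS 37 (2024), doi:10.1090/jams/1020), §2.1, §4
p. 10 · [Iwaniec2002] H. Iwaniec, *Spectral Methods of Automorphic Forms*, GSM 53, §6.2 (patching strips; the tree's ★ `FuchsianEisensteinContinued`).
-/

set_option autoImplicit false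
-- the mandated namespace repeats the single-problem summit's segment (`HodgeConjecture.HodgeConjecture`)
set_option linter.dupNamespace false

noncomputable section

open Filter Topology Set
open scoped Classical
open Literature.NumberTheory.Automorphic (toMeromorphicNFOn_eventuallyEq_of_eventuallyEq)

namespace Summit.HodgeConjecture.HodgeConjecture.Cruxes.H413.K2E1BLMeromorphicGluing

/-! ## §1 Scalarisation of a meromorphic vector-valued family through a continuous functional -/

/-- **SCALARISATION** [BernsteinLapid2019, §4 p. 10, «`E = ĥ⁻¹δ(h)E`, evaluation after `δ(h)` is a continuous functional»; cf. Iwaniec2002 Thm 1.16].  `v : ℂ → 𝓥` meromorphic on `D`,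
`Λ ∈ 𝓥'`, `ĥ` meromorphic on `D`, `E : ℂ → ℂ` arbitrary, `O ⊆ ℂ` arbitrary; if near every point of `D`, for `z` in a punctured neighbourhood, `z ∈ O → ĥ z ≠ 0 ∧ Λ (v z) = ĥ z * E z`,
then `z ↦ if z ∈ O then E z else (ĥ z)⁻¹ * Λ (v z)` is meromorphic on `D` (it is eventually equal to `ĥ⁻¹ · Λ ∘ v` near every point). [cite: BernsteinLapid2019, §4 p. 10]
[cite: Iwaniec2002, Thm 1.16] -/
theorem meromorphicOn_scalarisation {𝓥 : Type*} [NormedAddCommGroup 𝓥] [NormedSpace ℂ 𝓥] {D O : Set ℂ} {v : ℂ → 𝓥} (hv : MeromorphicOn v D) (Λ : 𝓥 →L[ℂ] ℂ)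
    {ĥ : ℂ → ℂ} (hĥ : MeromorphicOn ĥ D) (E : ℂ → ℂ) (h : ∀ z₀ ∈ D, ∀ᶠ z in 𝓝[≠] z₀, z ∈ O → ĥ z ≠ 0 ∧ Λ (v z) = ĥ z * E z) :
    MeromorphicOn (fun z => if z ∈ O then E z else (ĥ z)⁻¹ * Λ (v z)) D := by
  intro z₀ hz₀
  have hΦ : MeromorphicAt (fun z => (ĥ z)⁻¹ * Λ (v z)) z₀ := by
    have h1 : MeromorphicAt (ĥ⁻¹ * fun z => Λ (v z)) z₀ := (hĥ z₀ hz₀).inv.mul (Λ.comp_meromorphicAt (hv z₀ hz₀))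
    exact h1.congr (Eventually.of_forall fun z => rfl)
  refine hΦ.congr ?_
  filter_upwards [h z₀ hz₀] with z hz
  by_cases hzO : z ∈ O
  · obtain ⟨hne, heq⟩ := hz hzO
    rw [if_pos hzO, heq, inv_mul_cancel_left₀ hne]
  · rw [if_neg hzO]

/-- The scalarisation equals `E` on `O` (by definition). [folklore] -/
theorem scalarisation_eq {𝓥 : Type*} [NormedAddCommGroup 𝓥] [NormedSpace ℂ 𝓥] {O : Set ℂ} (v : ℂ → 𝓥) (Λ : 𝓥 →L[ℂ] ℂ) (ĥ E : ℂ → ℂ) {z : ℂ} (hz : z ∈ O) :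
    (fun z => if z ∈ O then E z else (ĥ z)⁻¹ * Λ (v z)) z = E z := by
  simp only [if_pos hz]

/-- Meromorphy transfers along eventual equality on punctured neighbourhoods of every point of the set (pointwise `MeromorphicAt.congr`). [folklore] -/
theorem meromorphicOn_of_eventuallyEq {𝓥 : Type*} [NormedAddCommGroup 𝓥] [NormedSpace ℂ 𝓥] {D : Set ℂ} {f g : ℂ → 𝓥} (hf : MeromorphicOn f D)
    (h : ∀ z₀ ∈ D, f =ᶠ[𝓝[≠] z₀] g) : MeromorphicOn g D := fun z₀ hz₀ => (hf z₀ hz₀).congr (h z₀ hz₀)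

/-! ## §2 Gluing normal forms over an exhaustion of `ℂ` -/

/-- **Normal forms agree pointwise on nested preconnected opens.**  `W ⊆ U` open-ish sets with `W` preconnected, `f` meromorphic on `U`, `f'` meromorphic on `W`, both equal near a point
`z₁ ∈ W` to one function `g` analytic at `z₁`: then `toMeromorphicNFOn f U = toMeromorphicNFOn f' W` at EVERY point of `W` (★ identity theorem for functions in normal form).
[cite: Iwaniec2002, §6.2 (normal forms independent of the kernel on overlapping strips)] -/
theorem toMeromorphicNFOn_eqOn_of_eventuallyEq {𝓥 : Type*} [NormedAddCommGroup 𝓥] [NormedSpace ℂ 𝓥] {U W : Set ℂ} (hWU : W ⊆ U) (hW : IsPreconnected W) {f f' g : ℂ → 𝓥}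
    (hf : MeromorphicOn f U) (hf' : MeromorphicOn f' W) {z₁ : ℂ} (hz₁ : z₁ ∈ W) (hg : AnalyticAt ℂ g z₁) (hfg : f =ᶠ[𝓝 z₁] g) (hf'g : f' =ᶠ[𝓝 z₁] g) :
    EqOn (toMeromorphicNFOn f U) (toMeromorphicNFOn f' W) W := by
  have h1 : toMeromorphicNFOn f U =ᶠ[𝓝 z₁] g := toMeromorphicNFOn_eventuallyEq_of_eventuallyEq hf (hWU hz₁) hg hfg
  have h2 : toMeromorphicNFOn f' W =ᶠ[𝓝 z₁] g := toMeromorphicNFOn_eventuallyEq_of_eventuallyEq hf' hz₁ hg hf'g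
  exact ((meromorphicNFOn_toMeromorphicNFOn f U).mono' hWU).eqOn_of_eventuallyEq (meromorphicNFOn_toMeromorphicNFOn f' W) hW hz₁
    ((h1.trans h2.symm).filter_mono nhdsWithin_le_nhds)

/-- **GLUING MEROMORPHIC PIECES OVER AN EXHAUSTION OF `ℂ`** [BernsteinLapid2019, §4 p. 10 with §2.1; Iwaniec2002 §6.2].  `D : ℕ → Set ℂ` open, preconnected, monotone, with
`∀ z, ∃ n, z ∈ D n`; `O` open; a base point `z₁ ∈ D 0 ∩ O`; `g` analytic on `O` (`AnalyticOnNhd`); pieces `F n` meromorphic on `D n` with `F n = g` on `D n ∩ O`.  THEN there is ONE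
`G : ℂ → ℂ`-style function (any complete normed target) meromorphic in normal form on all of `ℂ`, equal to `g` on `O`, and eventually equal near every `z ∈ D n` (punctured) to the piece `F n`
(so local properties of the pieces transfer).  Construction: `G z :=` the normal form of `F n` on `D n` at `z`, `n` the least index with `z ∈ D n`; pointwise consistency by
`toMeromorphicNFOn_eqOn_of_eventuallyEq`. [cite: BernsteinLapid2019, §2.1 and §4 p. 10] [cite: Iwaniec2002, §6.2] -/
theorem exists_meromorphicNFOn_univ_of_exhaustion {𝓥 : Type*} [NormedAddCommGroup 𝓥] [NormedSpace ℂ 𝓥] {D : ℕ → Set ℂ} (hDo : ∀ n, IsOpen (D n))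
    (hDc : ∀ n, IsPreconnected (D n)) (hmono : Monotone D) (hcov : ∀ z : ℂ, ∃ n, z ∈ D n) {O : Set ℂ} (hO : IsOpen O) {z₁ : ℂ} (hz₁ : z₁ ∈ D 0 ∩ O) {g : ℂ → 𝓥}
    (hg : AnalyticOnNhd ℂ g O) {F : ℕ → ℂ → 𝓥} (hF : ∀ n, MeromorphicOn (F n) (D n)) (hFg : ∀ n, EqOn (F n) g (D n ∩ O)) :
    ∃ G : ℂ → 𝓥, MeromorphicNFOn G univ ∧ EqOn G g O ∧ ∀ n, ∀ z ∈ D n, G =ᶠ[𝓝[≠] z] F n := by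
  -- the normal forms agree with `g` near `z₁`, hence pairwise on the smaller set
  have hnear : ∀ n, F n =ᶠ[𝓝 z₁] g := fun n =>
    eventually_of_mem (((hDo n).inter hO).mem_nhds ⟨hmono (Nat.zero_le n) hz₁.1, hz₁.2⟩) (hFg n)
  have hagree : ∀ {n m : ℕ}, n ≤ m → EqOn (toMeromorphicNFOn (F n) (D n)) (toMeromorphicNFOn (F m) (D m)) (D n) := fun {n m} hnm =>
    (toMeromorphicNFOn_eqOn_of_eventuallyEq (hmono hnm) (hDc n) (hF m) (hF n) (hmono (Nat.zero_le n) hz₁.1) (hg z₁ hz₁.2) (hnear m) (hnear n)).symm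
  -- the least index
  have hidx : ∀ z, z ∈ D (Nat.find (hcov z)) := fun z => Nat.find_spec (hcov z)
  have hmin : ∀ z n, z ∈ D n → Nat.find (hcov z) ≤ n := fun z n hz => Nat.find_min' (hcov z) hz
  refine ⟨fun z => toMeromorphicNFOn (F (Nat.find (hcov z))) (D (Nat.find (hcov z))) z, ?_, ?_, ?_⟩
  · -- locally `G` is the normal form of ONE piece
    intro z₀ _
    have hloc : (fun z => toMeromorphicNFOn (F (Nat.find (hcov z))) (D (Nat.find (hcov z))) z) =ᶠ[𝓝 z₀]
        toMeromorphicNFOn (F (Nat.find (hcov z₀))) (D (Nat.find (hcov z₀))) := by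
      filter_upwards [(hDo _).mem_nhds (hidx z₀)] with z hz
      exact hagree (hmin z _ hz) (hidx z)
    exact (meromorphicNFAt_congr hloc).2 (meromorphicNFOn_toMeromorphicNFOn _ _ (hidx z₀))
  · -- `G = g` on `O`
    intro z hz
    exact (toMeromorphicNFOn_eventuallyEq_of_eventuallyEq (hF _) (hidx z) (hg z hz)
      (eventually_of_mem (((hDo _).inter hO).mem_nhds ⟨hidx z, hz⟩) (hFg _))).eq_of_nhds
  · -- `G` is eventually the piece `F n` near every point of `D n`
    intro n z₀ hz₀
    have hloc : (fun z => toMeromorphicNFOn (F (Nat.find (hcov z))) (D (Nat.find (hcov z))) z) =ᶠ[𝓝 z₀] toMeromorphicNFOn (F n) (D n) := by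
      rcases le_total (Nat.find (hcov z₀)) n with hle | hle
      · filter_upwards [(hDo _).mem_nhds (hidx z₀)] with z hz
        exact (hagree (hmin z _ hz) (hidx z)).trans (hagree hle hz)
      · filter_upwards [(hDo n).mem_nhds hz₀] with z hz
        exact hagree (hmin z n hz) (hidx z)
    exact (hloc.filter_mono nhdsWithin_le_nhds).trans ((hF n).toMeromorphicNFOn_eq_self_on_nhdsNE hz₀)

/-- Corollary in the P8 currency: balls `D n = ball 0 (n + 2)` and the Godement half-plane `O = {1 < re}` (base point `3/2`). [cite: BernsteinLapid2019, §4 p. 10] -/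
theorem exists_meromorphicOn_univ_of_balls {𝓥 : Type*} [NormedAddCommGroup 𝓥] [NormedSpace ℂ 𝓥] [CompleteSpace 𝓥] {g : ℂ → 𝓥} (hg : DifferentiableOn ℂ g {z : ℂ | 1 < z.re})
    {F : ℕ → ℂ → 𝓥} (hF : ∀ n : ℕ, MeromorphicOn (F n) (Metric.ball (0 : ℂ) (n + 2)))
    (hFg : ∀ n : ℕ, ∀ z ∈ Metric.ball (0 : ℂ) (n + 2), 1 < z.re → F n z = g z) :
    ∃ G : ℂ → 𝓥, MeromorphicOn G univ ∧ (∀ z : ℂ, 1 < z.re → G z = g z) ∧ ∀ n : ℕ, ∀ z ∈ Metric.ball (0 : ℂ) (n + 2), G =ᶠ[𝓝[≠] z] F n := by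
  have hO : IsOpen {z : ℂ | 1 < z.re} := isOpen_lt continuous_const Complex.continuous_re
  have hz₁ : ((3 / 2 : ℝ) : ℂ) ∈ Metric.ball (0 : ℂ) ((0 : ℕ) + 2) ∩ {z : ℂ | 1 < z.re} := by
    refine ⟨?_, ?_⟩
    · rw [Metric.mem_ball, dist_zero_right, Complex.norm_real, Real.norm_eq_abs, abs_of_pos (by norm_num)]
      norm_num
    · show (1 : ℝ) < ((3 / 2 : ℝ) : ℂ).re
      rw [Complex.ofReal_re]
      norm_num
  have hcov : ∀ z : ℂ, ∃ n : ℕ, z ∈ Metric.ball (0 : ℂ) (n + 2) := fun z => by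
    obtain ⟨n, hn⟩ := exists_nat_gt ‖z‖
    exact ⟨n, by rw [Metric.mem_ball, dist_zero_right]; linarith⟩
  have hmono : Monotone fun n : ℕ => Metric.ball (0 : ℂ) (n + 2) := fun n m hnm =>
    Metric.ball_subset_ball (by exact_mod_cast Nat.add_le_add_right hnm 2)
  obtain ⟨G, hG, hGg, hGF⟩ := exists_meromorphicNFOn_univ_of_exhaustion (D := fun n : ℕ => Metric.ball (0 : ℂ) (n + 2)) (fun n => Metric.isOpen_ball)
    (fun n => (convex_ball (0 : ℂ) _).isPreconnected) hmono hcov hO hz₁ (hg.analyticOnNhd hO) hF (fun n z hz => hFg n z hz.1 hz.2)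
  exact ⟨G, hG.meromorphicOn, fun z hz => hGg hz, hGF⟩

/-! ## §3 Finitely many test functions per compact set; punctured-neighbourhood bookkeeping -/

/-- **Finite subfamily with no common zero on a compact set** [BernsteinLapid2019, §4 p. 10 «choose `h` such that `ĥ(s₀) ≠ 0`», made uniform on a compact `K`]: continuous `ĥ i` with
`∀ z ∈ K, ∃ i, ĥ i z ≠ 0` ⟹ a `Finset` of indices with the same property (finite subcover of `K` by the open sets `{ĥ i ≠ 0}`). [cite: BernsteinLapid2019, §4 p. 10] -/
theorem exists_finset_forall_exists_ne_zero {X : Type*} [TopologicalSpace X] {ι : Type*} {K : Set X} (hK : IsCompact K) {ĥ : ι → X → ℂ} (hc : ∀ i, Continuous (ĥ i))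
    (h : ∀ z ∈ K, ∃ i, ĥ i z ≠ 0) : ∃ s : Finset ι, ∀ z ∈ K, ∃ i ∈ s, ĥ i z ≠ 0 := by
  obtain ⟨s, hs⟩ := hK.elim_finite_subcover (fun i => {z | ĥ i z ≠ 0}) (fun i => isOpen_ne_fun (hc i) continuous_const) fun z hz => by
    obtain ⟨i, hi⟩ := h z hz
    exact mem_iUnion.2 ⟨i, hi⟩
  refine ⟨s, fun z hz => ?_⟩
  obtain ⟨i, hi⟩ := mem_iUnion.1 (hs hz)
  obtain ⟨his, hiz⟩ := mem_iUnion.1 hi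
  exact ⟨i, his, hiz⟩

/-- Closed balls in `ℂ` are compact, so finitely many `ĥ i` suffice on `closedBall 0 R` (the form consumed per ball of the exhaustion). [cite: BernsteinLapid2019, §4 p. 10] -/
theorem exists_finset_forall_exists_ne_zero_closedBall {ι : Type*} {ĥ : ι → ℂ → ℂ} (hc : ∀ i, Continuous (ĥ i)) (h : ∀ z : ℂ, ∃ i, ĥ i z ≠ 0) (R : ℝ) :
    ∃ s : Finset ι, ∀ z ∈ Metric.closedBall (0 : ℂ) R, ∃ i ∈ s, ĥ i z ≠ 0 :=
  exists_finset_forall_exists_ne_zero (isCompact_closedBall (0 : ℂ) R) hc fun z _ => h z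

/-- Bookkeeping: two punctured-eventual properties combine (the consumer feeds `∀ᶠ z in 𝓝[≠] z₀, z ∈ U` from ★ `exists_meromorphic_solution` (iv) and `∀ᶠ z in 𝓝[≠] z₀, ĥ z ≠ 0` from
★ `eventually_ne_zero_of_analyticOnNhd` into `meromorphicOn_scalarisation`). [folklore] -/
theorem eventually_imp_of_eventually_and {O U : Set ℂ} {z₀ : ℂ} {P Q : ℂ → Prop} (hU : ∀ᶠ z in 𝓝[≠] z₀, z ∈ U) (hP : ∀ᶠ z in 𝓝[≠] z₀, P z)
    (hQ : ∀ z ∈ U, z ∈ O → P z → Q z) : ∀ᶠ z in 𝓝[≠] z₀, z ∈ O → P z ∧ Q z := by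
  filter_upwards [hU, hP] with z hzU hzP
  exact fun hzO => ⟨hzP, hQ z hzU hzO hzP⟩

end Summit.HodgeConjecture.HodgeConjecture.Cruxes.H413.K2E1BLMeromorphicGluing

end
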